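import Summits.CriticalPhenomena.SAWScalingLimit.Theorems.SAWTotalPositivityCriticalBubbleBoundJoinInjective
import Summits.CriticalPhenomena.SAWScalingLimit.Theorems.SAWTotalPositivityCriticalBubbleBoundJoinEntropy

/-!
# Ears: global join plaquettes have positive density
(crux `SAWTotalPositivity.CriticalBubbleBound`, stmt-CriticalPhenomena-7117; line `docking-census-joining`,
registered stub `card_lexRooted_le_four_mul_sum_card_gjoins` of the join-mass programme, lead prover c7)

**Statement.** For every walk length `m ≥ 16`,
`#lexRooted m ≤ 4 · Σ_{χ ∈ lexRooted (m+4)} #gjoins (m+4) χ`: the un-restricted rarity mass `Urar` of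
GLOBAL join plaquettes carries a positive density of plaquettes per class, so the rarity exponent
`π = 0` (Hammond's Proposition 4.5) is SHARP for `Urar` — the certified reason why the line restricts to
MACROSCOPIC global join plaquettes.

**Proof (unit-square ears).** By Hammond's Lemma 4.9 in the class model (`card_lexRooted_le_four_mul`)
the left classes are a quarter of all classes, so it suffices to inject the left classes `χ` of walk
length `m` into the pairs `(χ', q')`, `χ' ∈ lexRooted (m+4)`, `q' ∈ gjoins (m+4) χ'`. Let
`T = (xmax, tipRow)` be the topmost rightmost vertex of `P(χ)`; its two polygon edges go west and south
(nothing of `P(χ)` lies right of `T`, nor above `T` in its column), so the vertical edge `{T - e₁, T}`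
lies on `P(χ)`. Glue the unit square `S` with lower-left corner `T - e₁ + e₀` (a `4`-edge polygon one
column to the right of `P(χ)`, hence vertex-disjoint from it) across the plaquette at `q = T - e₁`
(`flipV_merge`): the result `J` is a polygon with `(m+1) + 4` edges, `q` is a join plaquette of `J` and
its un-joining flip returns `P(χ) ∪ S`, with `S` above row `0` (a left class of walk length `≥ 16` has
`tipRow ≥ 2`, by `sq_height_ge`), `e₀ ∈ V(P(χ))` and the right column of `S` two columns right of
`P(χ)`. The abstract re-rooting `reroot_of_split` makes `(rerootWalk J (m+4), rerootSite J q)` such a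
pair. Injectivity: in the re-rooted frame the flip of the target class at the target site is the union
of the translated `P(χ)` and the translated square, vertex-disjoint, with the origin on the first member
(`frame_abstract`); two such decompositions with a common vertex on the first members coincide
(`pair_eq_of_common_vertex`), so `P(χ₂)` is a translate of `P(χ₁)`, and lex-rooted classes are rigid
(`eq_of_pedges_eq_trE`).

Sources: A. Hammond, *An upper bound on the number of self-avoiding polygons via joining*, Ann. Probab.
46 (2018) = arXiv:1808.09032, Definition 4.4, Proposition 4.5, Lemma 4.9; N. Madras, G. Slade,
*The Self-Avoiding Walk* (1993), Definition 3.2.1–3.2.2. Elementary combinatorics ([folklore]).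
-/

noncomputable section

open SimpleGraph
open Literature.Probability.LatticeModels
open Literature.Probability.RandomPlanarGeometry Literature.Probability.RandomPlanarGeometry.SAW
open scoped BigOperators
open Summit.CriticalPhenomena.SAWScalingLimit.Theorems.CriticalBubbleBound.Negative (e₀)
open Summit.CriticalPhenomena.SAWScalingLimit.Theorems.CriticalBubbleBound.Docking

namespace Summit.CriticalPhenomena.SAWScalingLimit.Theorems.CriticalBubbleBound.Join

/-! ## The topmost rightmost vertex and its south edge -/

/-- **Mirror corner lemma.** If `a` is a vertex of the rooted polygon of `ω ∈ sawFun 2 n e₀` (`n ≥ 2`)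
such that neither `a + e₀` nor `a + e₁` is a vertex, then `{a - e₁, a}` is an edge of the polygon (the
two polygon-neighbours of `a` are distinct lattice-neighbours, and only west and south are available).
[folklore] -/
private theorem mem_pedges_of_ne_corner {n : ℕ} {ω : ℕ → Site 2} (hω : ω ∈ Zd.sawFun 2 n e₀) (hn : 2 ≤ n)
    {a : Site 2} (ha : a ∈ verts n ω) (h₀ : a + e₀ ∉ verts n ω) (h₁ : a + e₁ ∉ verts n ω) :
    s(a - e₁, a) ∈ pedges n ω := by
  -- adapted from `Docking.mem_pedges_of_corner`
  obtain ⟨m, hm, rfl⟩ := Finset.mem_image.1 ha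
  obtain ⟨p, hp, q, hq, hpq, hap, haq, hpe, hqe⟩ :=
    two_neighbours hω hn (Nat.lt_succ_iff.1 (Finset.mem_range.1 hm))
  rcases adj_cases hap with rfl | rfl | rfl | rfl <;>
    rcases adj_cases haq with rfl | rfl | rfl | rfl <;>
    first
    | exact (h₀ hp).elim
    | exact (h₀ hq).elim
    | exact (h₁ hp).elim
    | exact (h₁ hq).elim
    | exact (hpq rfl).elim
    | (rw [Sym2.eq_swap]; exact hpe)
    | (rw [Sym2.eq_swap]; exact hqe)

/-- The topmost rightmost vertex `T = (xmax, tipRow)` is a rightmost vertex. [folklore] -/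
private theorem tip_mem_rightCol (n : ℕ) (χ : ℕ → Site 2) : (![xmax n χ, tipRow n χ] : Site 2) ∈ rightCol n χ := by
  -- adapted from `esVertex_mem_rightCol`
  obtain ⟨v, hv, hv1⟩ := exists_eq_tipRow n χ
  have hv0 := (mem_rightCol.1 hv).2
  have : (![xmax n χ, tipRow n χ] : Site 2) = v := by
    ext j; fin_cases j
    · simp [hv0]
    · simp [← hv1]
  rw [this]; exact hv

/-- The SOUTH edge `{T - e₁, T}` of the topmost rightmost vertex `T` lies on the rooted polygon
(`T + e₀` is right of the rightmost column, `T + e₁` would be a higher rightmost vertex). [folklore] -/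
private theorem tip_south_edge_mem {n : ℕ} {χ : ℕ → Site 2} (hχ : χ ∈ Zd.sawFun 2 n e₀) (hn : 2 ≤ n) :
    s(![xmax n χ, tipRow n χ] - e₁, ![xmax n χ, tipRow n χ] - e₁ + e₁) ∈ pedges n χ := by
  rw [sub_add_cancel]
  obtain ⟨hTv, hT0⟩ := mem_rightCol.1 (tip_mem_rightCol n χ)
  have hT1 : (![xmax n χ, tipRow n χ] : Site 2) 1 = tipRow n χ := by simp
  refine mem_pedges_of_ne_corner hχ hn hTv (fun h => ?_) (fun h => ?_)
  · have h2 := (bounds_of_mem_verts h).2.1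
    simp only [Pi.add_apply, e₀_e₁_apply.1] at h2
    omega
  · have h' : (![xmax n χ, tipRow n χ] : Site 2) + e₁ ∈ rightCol n χ :=
      mem_rightCol.2 ⟨h, by simp only [Pi.add_apply, e₀_e₁_apply.2.2.1]; omega⟩
    have h2 := le_tipRow h'
    simp only [Pi.add_apply, e₀_e₁_apply.2.2.2] at h2
    omega

/-! ## Unit squares -/

/-- **Unit squares.** For every site `c` there is a `4`-edge polygon (the boundary of the unit square
with lower-left corner `c`) containing the edge `{c, c + e₁}`, having `c + e₀` as a vertex, all of whose
vertices have abscissa `c 0` or `c 0 + 1` and ordinate `c 1` or `c 1 + 1`. [folklore] -/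
private theorem exists_squares : ∃ sq : Site 2 → Finset (Sym2 (Site 2)), ∀ c : Site 2,
    IsPolygon (zdGraph 2) (sq c) ∧ (sq c).card = 4 ∧ s(c, c + e₁) ∈ sq c ∧ IsV (sq c) (c + e₀) ∧
      ∀ x, IsV (sq c) x → (x 0 = c 0 ∨ x 0 = c 0 + 1) ∧ (x 1 = c 1 ∨ x 1 = c 1 + 1) := by
  classical
  have H : ∀ c : Site 2, ∃ S : Finset (Sym2 (Site 2)), IsPolygon (zdGraph 2) S ∧ S.card = 4 ∧
      s(c, c + e₁) ∈ S ∧ IsV S (c + e₀) ∧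
      ∀ x, IsV S x → (x 0 = c 0 ∨ x 0 = c 0 + 1) ∧ (x 1 = c 1 ∨ x 1 = c 1 + 1) := by
    intro c
    obtain ⟨c1, c2, c3, c4, c5, c6⟩ := corners_ne c
    have h₃ : (zdGraph 2).Adj (c + e₀ + e₁) (c + e₁) := by
      have h := adj_add_e₀ (c + e₁)
      rw [add_right_comm] at h
      exact h.symm
    let P : (zdGraph 2).Walk c (c + e₁) :=
      Walk.cons (adj_add_e₀ c) (Walk.cons (adj_add_e₁ (c + e₀)) (Walk.cons h₃ Walk.nil))
    have hPe : P.edges = [s(c, c + e₀), s(c + e₀, c + e₀ + e₁), s(c + e₀ + e₁, c + e₁)] := by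
      simp [P]
    have hPl : P.length = 3 := by simp [P]
    have hP : P.IsPath := by
      simp only [P, Walk.cons_isPath_iff, Walk.IsPath.nil, Walk.support_cons, Walk.support_nil,
        List.mem_cons, List.not_mem_nil, or_false, true_and]
      exact ⟨⟨fun h => c6 h, fun h => h.elim (fun h => c5 h.symm) fun h => c4 h⟩,
        fun h => h.elim (fun h => c1 h.symm) fun h => h.elim (fun h => c3 h.symm) fun h => c2 h.symm⟩
    have hne : s(c, c + e₁) ∉ P.edges := by
      rw [hPe]
      simp only [List.mem_cons, List.not_mem_nil, or_false, not_or]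
      refine ⟨(lo_ne_left c).symm, left_ne_right c, fun h => ?_⟩
      rw [Sym2.eq_iff] at h
      rcases h with ⟨h, -⟩ | ⟨-, h⟩
      · exact c3 h.symm
      · exact c6 h.symm
    obtain ⟨hpoly, hcard⟩ := isPolygon_insert_of_isPath hP (adj_add_e₁ c).symm hne
    refine ⟨_, hpoly, by rw [hcard, hPl], Finset.mem_insert_self _ _, ?_, ?_⟩
    · refine ⟨s(c, c + e₀), Finset.mem_insert_of_mem ?_, Sym2.mem_mk_right _ _⟩
      rw [List.mem_toFinset, hPe]
      simp
    · rintro x ⟨e, he, hx⟩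
      rw [Finset.mem_insert, List.mem_toFinset, hPe] at he
      simp only [List.mem_cons, List.not_mem_nil, or_false] at he
      have he' := e₀_e₁_apply
      have hx' : x = c ∨ x = c + e₀ ∨ x = c + e₁ ∨ x = c + e₀ + e₁ := by
        rcases he with rfl | rfl | rfl | rfl <;> rcases Sym2.mem_iff.1 hx with rfl | rfl <;> simp
      rcases hx' with rfl | rfl | rfl | rfl
      · exact ⟨Or.inl rfl, Or.inl rfl⟩
      · exact ⟨Or.inr (by rw [Pi.add_apply, he'.1]), Or.inl (by rw [Pi.add_apply, he'.2.1, add_zero])⟩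
      · exact ⟨Or.inl (by rw [Pi.add_apply, he'.2.2.1, add_zero]), Or.inr (by rw [Pi.add_apply, he'.2.2.2])⟩
      · exact ⟨Or.inr (by rw [Pi.add_apply, Pi.add_apply, he'.1, he'.2.2.1, add_zero]),
          Or.inr (by rw [Pi.add_apply, Pi.add_apply, he'.2.1, he'.2.2.2, add_zero])⟩
  choose sq hsq using H
  exact ⟨sq, hsq⟩

/-! ## The ear of a left class -/

/-- A left class of walk length `m ≥ 16` has its tip row at least `2`: it is tall, so
`(height + 1)² ≥ m + 1 ≥ 17` forces `height ≥ 4`, and the tip lies in the upper half.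
[cite: Hammond2015SAPJoining, Definition 4.8] -/
private theorem two_le_tipRow {m : ℕ} (hm : 16 ≤ m) {χ : ℕ → Site 2} (hχ : χ ∈ lexRooted m)
    (hl : IsLeftPoly m χ) : 2 ≤ tipRow m χ := by
  obtain ⟨ht, htip⟩ := hl
  have hsq := sq_height_ge hχ ht
  have hy0 := ymin_eq_zero_of_mem_lexRooted hχ
  have hh : height m χ = ymax m χ := by rw [height, hy0, sub_zero]
  have hm' : (17 : ℤ) ≤ (m : ℤ) + 1 := by
    have : (16 : ℤ) ≤ (m : ℤ) := by exact_mod_cast hm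
    omega
  have h0 : 0 ≤ height m χ := by rw [hh]; exact ymax_nonneg_of_mem_lexRooted hχ
  have h4 : 4 ≤ height m χ := by
    by_contra hcon
    have h3 : height m χ ≤ 3 := by omega
    nlinarith
  rw [hy0, zero_add] at htip
  omega

/-- **The ear of a left class.** For a left class `χ` of walk length `m ≥ 16` with topmost rightmost
vertex `T`, `q = T - e₁`, and a `4`-edge polygon `S ∋ {q + e₀, q + e₀ + e₁}` living in the columns
`xmax + 1`, `xmax + 2` and the rows `tipRow - 1`, `tipRow` with `q + 2 e₀ ∈ V(S)`: gluing `S` to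
`P(χ)` across the plaquette at `q` (`flipV_merge`) gives a polygon `J` with `m + 5` edges, a join
plaquette at `q` whose un-joining flip returns `P(χ) ∪ S` — vertex-disjoint polygons with `S` above
row `0`, `e₀ ∈ V(P(χ))` and a vertex of `S` two columns right of `P(χ)` (the hypotheses of
`reroot_of_split`). [cite: Hammond2015SAPJoining, Definition 4.4] -/
private theorem ear_split {m : ℕ} (hm : 16 ≤ m) {χ : ℕ → Site 2} (hχ : χ ∈ lexRooted m)
    (hl : IsLeftPoly m χ) {q : Site 2} (hq : q = ![xmax m χ, tipRow m χ] - e₁)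
    {S : Finset (Sym2 (Site 2))} (hS : IsPolygon (zdGraph 2) S) (hSc : S.card = 4)
    (hSe : s(q + e₀, q + e₀ + e₁) ∈ S) (hSw : IsV S (q + e₀ + e₀))
    (hSv : ∀ x, IsV S x → (x 0 = (q + e₀) 0 ∨ x 0 = (q + e₀) 0 + 1) ∧ (x 1 = (q + e₀) 1 ∨ x 1 = (q + e₀) 1 + 1)) :
    IsPolygon (zdGraph 2) (flipV (pedges m χ ∪ S) q) ∧ (flipV (pedges m χ ∪ S) q).card = m + 4 + 1 ∧
      IsJoinPlaq (flipV (pedges m χ ∪ S) q) q ∧ IsPolygon (zdGraph 2) (pedges m χ) ∧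
      (∀ x : Site 2, IsV (pedges m χ) x → IsV S x → False) ∧
      flipH (flipV (pedges m χ ∪ S) q) q = pedges m χ ∪ S ∧
      (∀ x : Site 2, IsV S x → 1 ≤ x 1) ∧ IsV (pedges m χ) e₀ ∧
      ∃ w : Site 2, IsV S w ∧ ∀ x : Site 2, IsV (pedges m χ) x → x 0 + 2 ≤ w 0 := by
  have hω := lexRooted_subset m hχ
  have hm2 : 2 ≤ m := le_trans (by norm_num) hm
  have hm3 : 3 ≤ m := le_trans (by norm_num) hm
  have htip := two_le_tipRow hm hχ hl
  have hq0 : q 0 = xmax m χ := by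
    rw [hq, Pi.sub_apply, e₀_e₁_apply.2.2.1, sub_zero]
    simp
  have hq1 : q 1 = tipRow m χ - 1 := by
    rw [hq, Pi.sub_apply, e₀_e₁_apply.2.2.2]
    simp
  have hc0 : (q + e₀) 0 = xmax m χ + 1 := by rw [Pi.add_apply, hq0, e₀_e₁_apply.1]
  have hc1 : (q + e₀) 1 = tipRow m χ - 1 := by rw [Pi.add_apply, hq1, e₀_e₁_apply.2.1, add_zero]
  -- the polygon `P(χ)`, its left side of the plaquette, vertex-disjointness from `S`
  have hT : IsPolygon (zdGraph 2) (pedges m χ) := isPolygon_pedges m χ hω hm3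
  have hlf : s(q, q + e₁) ∈ pedges m χ := by rw [hq]; exact tip_south_edge_mem hω hm2
  have hxT : ∀ x : Site 2, IsV (pedges m χ) x → x 0 ≤ xmax m χ := fun x hx =>
    (bounds_of_mem_verts (exists_mem_pedges_iff.1 hx)).2.1
  have hdis : ∀ x : Site 2, IsV (pedges m χ) x → IsV S x → False := by
    intro x hx hxS
    have h1 := hxT x hx
    have h2 := (hSv x hxS).1
    rw [hc0] at h2
    omega
  obtain ⟨hJ, hJc, hplaq, hflip⟩ := flipV_merge (pedges m χ) S q hT hS hdis hlf hSe
  refine ⟨hJ, ?_, hplaq, hT, hdis, hflip, fun x hxS => ?_, ?_, ⟨q + e₀ + e₀, hSw, fun x hx => ?_⟩⟩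
  · rw [hJc, card_pedges hω hm2, hSc]
  · have h2 := (hSv x hxS).2
    rw [hc1] at h2
    omega
  · exact ⟨rootEdge, rootEdge_mem_pedges_of_mem_sawFun hω, Sym2.mem_mk_right _ _⟩
  · have h1 := hxT x hx
    rw [Pi.add_apply, hc0, e₀_e₁_apply.1]
    omega

/-! ## The stub -/

/-- **Stub `card_lexRooted_le_four_mul_sum_card_gjoins` (ears: global join plaquettes have positive
density).** For `m ≥ 16`, `#lexRooted m ≤ 4 · Σ_{χ ∈ lexRooted (m+4)} #gjoins (m+4) χ`: the left
classes are a quarter of all classes (Lemma 4.9), and gluing a unit square to the right of the topmost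
rightmost vertex of a left class and re-rooting gives, injectively, a class of walk length `m + 4`
together with a GLOBAL join plaquette of it. Hence the rarity exponent `π = 0` of Proposition 4.5 is
sharp for the un-restricted mass `Urar`. [cite: Hammond2015SAPJoining, Proposition 4.5] -/
theorem card_lexRooted_le_four_mul_sum_card_gjoins : ∀ m : ℕ, 16 ≤ m → (lexRooted m).card ≤ 4 * ∑ χ ∈ lexRooted (m + 4), (gjoins (m + 4) χ).card := by
  intro m hm
  classical
  obtain ⟨sq, hsq⟩ := exists_squares
  have hm2 : 2 ≤ m := le_trans (by norm_num) hm
  refine le_trans (card_lexRooted_le_four_mul m (le_trans (by norm_num) hm)) (Nat.mul_le_mul_left 4 ?_)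
  -- the ear data of a class: the plaquette corner `q χ` and the glued polygon `J χ`
  set q : (ℕ → Site 2) → Site 2 := fun χ => ![xmax m χ, tipRow m χ] - e₁ with hq
  set J : (ℕ → Site 2) → Finset (Sym2 (Site 2)) := fun χ => flipV (pedges m χ ∪ sq (q χ + e₀)) (q χ)
    with hJ
  have key : ∀ χ : ℕ → Site 2, χ ∈ lexRooted m → IsLeftPoly m χ →
      (rerootWalk (J χ) (m + 4) ∈ lexRooted (m + 4) ∧
        rerootSite (J χ) (q χ) ∈ gjoins (m + 4) (rerootWalk (J χ) (m + 4))) ∧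
      IsPolygon (zdGraph 2) (trE (-lexMinV (vxs (J χ))) (pedges m χ)) ∧
      (∀ x, IsV (trE (-lexMinV (vxs (J χ))) (pedges m χ)) x →
        IsV (trE (-lexMinV (vxs (J χ))) (sq (q χ + e₀))) x → False) ∧
      trE (-lexMinV (vxs (J χ))) (pedges m χ) ∪ trE (-lexMinV (vxs (J χ))) (sq (q χ + e₀)) =
        flipH (pedges (m + 4) (rerootWalk (J χ) (m + 4))) (rerootSite (J χ) (q χ)) ∧
      IsV (trE (-lexMinV (vxs (J χ))) (pedges m χ)) 0 := by
    intro χ hχ hl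
    obtain ⟨hS, hSc, hSe, hSw, hSv⟩ := hsq (q χ + e₀)
    obtain ⟨hJp, hJc, hplaq, hT, hdis, hflip, hSrow, he₀, hw⟩ :=
      ear_split hm hχ hl (q := q χ) rfl hS hSc hSe hSw hSv
    obtain ⟨hL, hpe, hG⟩ := reroot_of_split hJp hJc hplaq hT hS hdis hflip hSrow he₀ hw
    exact ⟨⟨hL, hG⟩, frame_abstract hplaq hT hdis hflip hSrow he₀ hpe⟩
  rw [← Finset.card_sigma]
  refine Finset.card_le_card_of_injOn
    (fun χ => (⟨rerootWalk (J χ) (m + 4), rerootSite (J χ) (q χ)⟩ : Σ _ : ℕ → Site 2, Site 2))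
    (fun χ hχ => ?_) ?_
  · rw [Finset.mem_coe, Finset.mem_filter] at hχ
    rw [Finset.mem_coe, Finset.mem_sigma]
    exact (key χ hχ.1 hχ.2).1
  · intro χ₁ h₁ χ₂ h₂ heq
    rw [Finset.mem_coe, Finset.mem_filter] at h₁ h₂
    obtain ⟨-, hP₁, hd₁, hU₁, hz₁⟩ := key χ₁ h₁.1 h₁.2
    obtain ⟨-, hP₂, hd₂, hU₂, hz₂⟩ := key χ₂ h₂.1 h₂.2
    obtain ⟨hW, hs⟩ := Sigma.mk.inj_iff.1 heq
    have hs' := eq_of_heq hs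
    rw [hW, hs'] at hU₁
    obtain ⟨hA, -⟩ := pair_eq_of_common_vertex hP₁ hP₂ hd₁ hd₂ (hU₁.trans hU₂.symm) hz₁ hz₂
    have hpe : pedges m χ₂ = trE (-lexMinV (vxs (J χ₁)) + lexMinV (vxs (J χ₂))) (pedges m χ₁) := by
      rw [← trE_trE, hA, trE_trE_neg]
    exact ((eq_of_pedges_eq_trE hm2 h₁.1 h₂.1 hpe).2).symm

end Summit.CriticalPhenomena.SAWScalingLimit.Theorems.CriticalBubbleBound.Join

end
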